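import Mathlib
import HarnessLib
import Literature.Barriers.ValiantsHypothesis.MonotoneGapParseTrees

/-!
# Monotone formula lower bounds I — the log-product covering property (support file 1/3)

Support for crux item `stmt-ValiantsHypothesis-15886` (`MonotoneRestorationQP`), TTRL-lite
variant V20269 of `stub_esymmRowSums_complexity` (formula complexity instead of circuit
complexity), which is FALSE: monotone formulas for `e_{⌊n/2⌋}` of the row sums have size
`n^{Ω(log n)}` (Shamir–Snir 1980; Hrubeš–Yehudayoff 2011, log-product decomposition).

This file: the covering property `Good[f, s]` (a local notation, deliberately not a
definition) — for every depth `T`, degree `κ` and threshold `θ` (`⌊2κ/3⌋ ≤ θ < κ`,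
`3^T ≤ θ + 1`) the monomials of the homogeneous polynomial `f ≠ 0` over `ℝ≥0` are covered by at
most `s` *chain products* `C 0 ⋯ C T` whose degrees follow a geometric chain
(`Cont[T, κ, θ; C]`) and whose monomials are monomials of `f` — and its closure under the
formula operations: leaves, nonnegative linear combinations, and products (split / merge at the
threshold: the Hrubeš–Yehudayoff log-product step, with no cancellations over `ℝ≥0`).

References: P. Hrubeš, A. Yehudayoff, *Homogeneous formulas and symmetric polynomials*,
Comput. Complexity 20 (2011) 559–578, §3; E. Shamir, M. Snir, *On the depth complexity of
formulas*, Math. Systems Theory 13 (1980) 301–322.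
-/

-- `Summit.ValiantsHypothesis.ValiantsHypothesis.…` is the tree's single-conjunct layout (Sub = Summit).
set_option linter.dupNamespace false

noncomputable section

namespace Summit.ValiantsHypothesis.ValiantsHypothesis.Theorems.MonotoneFormulaLB

open Literature.Computability.AlgebraicComplexity
open MvPolynomial ArithCircuit
open Literature.Barriers.ValiantsHypothesis.JerrumSnir
open scoped NNReal Pointwise

variable {σ : Type} [DecidableEq σ]

/-- `Hom[f, d]`: every monomial of `f` has degree `d` (local notation). -/
local notation3 "Hom[" f ", " d "]" =>
  ∀ m ∈ MvPolynomial.support f, Finsupp.degree m = (d : ℕ)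

/-- `Cont[T, κ, θ; C]`: `C 0, …, C T` is a log-product chain of depth `T` for degree `κ` and
threshold `θ` (local notation). -/
local notation3 "Cont[" T ", " κ ", " θ "; " C "]" =>
  ∃ K : ℕ → ℕ, K 0 = (κ : ℕ) ∧ (0 < (T : ℕ) → (θ : ℕ) < 2 * K 1 ∧ K 1 ≤ θ) ∧
    (∀ j : ℕ, 0 < j → j < T → 3 * K (j + 1) ≤ 2 * K j ∧ K j < 3 * K (j + 1)) ∧
    (∀ j : ℕ, j < T → K (j + 1) ≤ K j ∧
      ∀ m ∈ MvPolynomial.support ((C : ℕ → MvPolynomial _ ℝ≥0) j),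
        Finsupp.degree m = K j - K (j + 1)) ∧
    (∀ m ∈ MvPolynomial.support ((C : ℕ → MvPolynomial _ ℝ≥0) T), Finsupp.degree m = K T) ∧
    (∀ j : ℕ, j ≤ T → (C : ℕ → MvPolynomial _ ℝ≥0) j ≠ 0)

/-- `Good[f, s]`: the log-product covering property with `s` terms (local notation). -/
local notation3 "Good[" f ", " s "]" =>
  ∀ T κ θ : ℕ, f ≠ 0 → (∀ m ∈ MvPolynomial.support f, Finsupp.degree m = κ) →
    2 * κ ≤ 3 * θ + 2 → θ < κ → 3 ^ T ≤ θ + 1 →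
    ∃ L : List (ℕ → MvPolynomial _ ℝ≥0), L.length ≤ (s : ℕ) ∧
      (∀ C ∈ L, Cont[T, κ, θ; C] ∧
        MvPolynomial.support (∏ j ∈ Finset.range (T + 1), C j) ⊆ MvPolynomial.support f) ∧
      (∀ m ∈ MvPolynomial.support f, ∃ C ∈ L,
        m ∈ MvPolynomial.support (∏ j ∈ Finset.range (T + 1), C j))

/-! ### Positivity and homogeneity over `ℝ≥0` -/

omit [DecidableEq σ] in
/-- Over `ℝ≥0` a product of nonzero polynomials is nonzero. [folklore] -/
theorem nnreal_mul_ne_zero {f g : MvPolynomial σ ℝ≥0} (hf : f ≠ 0) (hg : g ≠ 0) : f * g ≠ 0 := by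
  classical
  intro h
  obtain ⟨a, ha⟩ := support_nonempty.2 hf
  obtain ⟨b, hb⟩ := support_nonempty.2 hg
  have : a + b ∈ (f * g).support := by
    rw [support_mul_eq]; exact Finset.add_mem_add ha hb
  rw [h, support_zero] at this
  exact Finset.notMem_empty _ this

/-- Degrees add on the monomials of a product. [folklore] -/
theorem hom_mul {f g : MvPolynomial σ ℝ≥0} {a b : ℕ} (hf : Hom[f, a]) (hg : Hom[g, b]) :
    Hom[f * g, a + b] := by
  intro m hm
  rw [support_mul_eq] at hm
  obtain ⟨x, hx, y, hy, rfl⟩ := Finset.mem_add.1 hm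
  rw [map_add, hf x hx, hg y hy]

/-- Over `ℝ≥0`, the nonzero factors of a homogeneous product are homogeneous of complementary
degrees. [folklore] -/
theorem hom_of_mul {f g : MvPolynomial σ ℝ≥0} {κ : ℕ} (h : Hom[f * g, κ]) (hf : f ≠ 0)
    (hg : g ≠ 0) : ∃ a b : ℕ, a + b = κ ∧ Hom[f, a] ∧ Hom[g, b] := by
  obtain ⟨x, hx⟩ := support_nonempty.2 hf
  obtain ⟨y, hy⟩ := support_nonempty.2 hg
  have hxy : Finsupp.degree x + Finsupp.degree y = κ := by
    rw [← map_add]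
    exact h _ (by rw [support_mul_eq]; exact Finset.add_mem_add hx hy)
  refine ⟨Finsupp.degree x, Finsupp.degree y, hxy, fun m hm => ?_, fun m hm => ?_⟩
  · have := h (m + y) (by rw [support_mul_eq]; exact Finset.add_mem_add hm hy)
    rw [map_add] at this
    omega
  · have := h (x + m) (by rw [support_mul_eq]; exact Finset.add_mem_add hx hm)
    rw [map_add] at this
    omega

/-! ### The covering property: closure under the formula operations -/

omit [DecidableEq σ] in
/-- Depth `T = 0`: the single chain `(f)` covers `f`. [folklore] -/
theorem good_zero_depth {f : MvPolynomial σ ℝ≥0} {κ θ s : ℕ} (hf : f ≠ 0) (hh : Hom[f, κ])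
    (hs : 1 ≤ s) :
    ∃ L : List (ℕ → MvPolynomial σ ℝ≥0), L.length ≤ s ∧
      (∀ C ∈ L, Cont[0, κ, θ; C] ∧
        MvPolynomial.support (∏ j ∈ Finset.range (0 + 1), C j) ⊆ MvPolynomial.support f) ∧
      (∀ m ∈ MvPolynomial.support f, ∃ C ∈ L,
        m ∈ MvPolynomial.support (∏ j ∈ Finset.range (0 + 1), C j)) := by
  refine ⟨[fun _ => f], by simpa using hs, fun C hC => ?_, fun m hm => ⟨fun _ => f, by simp, ?_⟩⟩
  · rw [List.mem_singleton] at hC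
    subst hC
    refine ⟨⟨fun _ => κ, rfl, fun h => absurd h (lt_irrefl 0), fun j _ hj => absurd hj (by omega),
      fun j hj => absurd hj (by omega), by simpa using hh, fun j _ => hf⟩, by simp⟩
  · simpa using hm

omit [DecidableEq σ] in
/-- `Good` depends on `f` only through its monomial set. [folklore] -/
theorem good_congr {f g : MvPolynomial σ ℝ≥0} {s : ℕ} (hfg : f.support = g.support)
    (h : Good[f, s]) : Good[g, s] := by
  intro T κ θ hg hh h1 h2 h3
  have hf : f ≠ 0 := by
    intro hf; apply hg
    rw [← support_eq_empty, ← hfg, hf, support_zero]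
  rw [← hfg] at hh ⊢
  exact h T κ θ hf hh h1 h2 h3

omit [DecidableEq σ] in
/-- The zero polynomial is (vacuously) good. [folklore] -/
theorem good_zero (s : ℕ) : Good[(0 : MvPolynomial σ ℝ≥0), s] :=
  fun _ _ _ h => absurd rfl h

omit [DecidableEq σ] in
/-- Constants are (vacuously) good: they are not homogeneous of positive degree. [folklore] -/
theorem good_C (a : ℝ≥0) (s : ℕ) : Good[(C a : MvPolynomial σ ℝ≥0), s] := by
  intro T κ θ h0 hh h1 h2 h3
  exfalso
  have ha : a ≠ 0 := by rintro rfl; exact h0 (by simp)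
  have := hh 0 (by rw [support_C, if_neg ha]; exact Finset.mem_singleton_self _)
  rw [map_zero] at this
  omega

omit [DecidableEq σ] in
/-- A variable is good with one term. [folklore] -/
theorem good_X (i : σ) : Good[(X i : MvPolynomial σ ℝ≥0), 1] := by
  intro T κ θ h0 hh h1 h2 h3
  have hκ : κ = 1 := by
    have := hh (Finsupp.single i 1) (by rw [support_X]; exact Finset.mem_singleton_self _)
    rw [Finsupp.degree_single] at this
    exact this.symm
  subst hκ
  have hθ : θ = 0 := by omega
  subst hθ
  have hT : T = 0 := by
    rcases Nat.eq_zero_or_pos T with hT | hT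
    · exact hT
    · exfalso
      have : 3 ≤ 3 ^ T := by
        calc (3 : ℕ) = 3 ^ 1 := by norm_num
          _ ≤ 3 ^ T := Nat.pow_le_pow_right (by norm_num) hT
      omega
  subst hT
  exact good_zero_depth h0 hh le_rfl

omit [DecidableEq σ] in
/-- Monotonicity in the number of terms. [folklore] -/
theorem good_mono {f : MvPolynomial σ ℝ≥0} {s t : ℕ} (h : Good[f, s]) (hst : s ≤ t) :
    Good[f, t] := by
  intro T κ θ h0 hh h1 h2 h3
  obtain ⟨L, hL, hC, hcov⟩ := h T κ θ h0 hh h1 h2 h3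
  exact ⟨L, hL.trans hst, hC, hcov⟩

/-- Closure under sums: over `ℝ≥0`, `mon(f + g) = mon f ∪ mon g`. [folklore] -/
theorem good_add {f g : MvPolynomial σ ℝ≥0} {s t : ℕ} (hf : Good[f, s]) (hg : Good[g, t]) :
    Good[f + g, s + t] := by
  intro T κ θ h0 hh h1 h2 h3
  by_cases hf0 : f = 0
  · subst hf0
    rw [zero_add] at h0 hh ⊢
    obtain ⟨L, hL, hC, hcov⟩ := hg T κ θ h0 hh h1 h2 h3
    exact ⟨L, by omega, hC, hcov⟩
  by_cases hg0 : g = 0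
  · subst hg0
    rw [add_zero] at h0 hh ⊢
    obtain ⟨L, hL, hC, hcov⟩ := hf T κ θ h0 hh h1 h2 h3
    exact ⟨L, by omega, hC, hcov⟩
  rw [support_add_eq] at hh ⊢
  obtain ⟨L₁, hL₁, hC₁, hcov₁⟩ :=
    hf T κ θ hf0 (fun m hm => hh m (Finset.mem_union_left _ hm)) h1 h2 h3
  obtain ⟨L₂, hL₂, hC₂, hcov₂⟩ :=
    hg T κ θ hg0 (fun m hm => hh m (Finset.mem_union_right _ hm)) h1 h2 h3
  refine ⟨L₁ ++ L₂, by rw [List.length_append]; omega, fun C hC => ?_, fun m hm => ?_⟩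
  · rcases List.mem_append.1 hC with hC | hC
    · exact ⟨(hC₁ C hC).1, (hC₁ C hC).2.trans Finset.subset_union_left⟩
    · exact ⟨(hC₂ C hC).1, (hC₂ C hC).2.trans Finset.subset_union_right⟩
  · rcases Finset.mem_union.1 hm with hm | hm
    · obtain ⟨C, hC, hmC⟩ := hcov₁ m hm
      exact ⟨C, List.mem_append_left _ hC, hmC⟩
    · obtain ⟨C, hC, hmC⟩ := hcov₂ m hm
      exact ⟨C, List.mem_append_right _ hC, hmC⟩

omit [DecidableEq σ] in
/-- Closure under nonnegative scalars. [folklore] -/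
theorem good_smul {f : MvPolynomial σ ℝ≥0} {s : ℕ} (a : ℝ≥0) (hf : Good[f, s]) :
    Good[a • f, s] := by
  by_cases ha : a = 0
  · subst ha
    rw [zero_smul]
    exact good_zero s
  · exact good_congr (MvPolynomial.support_smul_eq ha f).symm hf

omit [DecidableEq σ] in
/-- Product of a prepended chain. [folklore] -/
theorem prod_prepend (x : MvPolynomial σ ℝ≥0) (C : ℕ → MvPolynomial σ ℝ≥0) (n : ℕ) :
    ∏ j ∈ Finset.range (n + 1), (fun j => if j = 0 then x else C (j - 1)) j =
      (∏ j ∈ Finset.range n, C j) * x := by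
  rw [Finset.prod_range_succ']
  simp

omit [DecidableEq σ] in
/-- Product of a chain whose head was multiplied by `x`. [folklore] -/
theorem prod_merge (x : MvPolynomial σ ℝ≥0) (C : ℕ → MvPolynomial σ ℝ≥0) (n : ℕ) :
    ∏ j ∈ Finset.range (n + 1), (fun j => if j = 0 then x * C 0 else C j) j =
      (∏ j ∈ Finset.range (n + 1), C j) * x := by
  rw [Finset.prod_range_succ', Finset.prod_range_succ']
  simp only [Nat.succ_ne_zero, if_false, if_true]
  ring

/-- Closure under products, given the degrees of the two (nonzero) factors with the heavier
factor `f` on the left: split (`deg f ≤ θ`: `g` becomes a new head of the chains of `f`) or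
merge (`θ < deg f`: `g` is multiplied into the heads of the chains of `f`).
[cite: HrubesYehudayoffHomogeneous2011, §3 (log-product lemma)] -/
theorem good_mul_of_le {f g : MvPolynomial σ ℝ≥0} {s : ℕ} (hf : Good[f, s]) (hs : 1 ≤ s)
    {T κ θ a b : ℕ} (hf0 : f ≠ 0) (hg0 : g ≠ 0) (ha : Hom[f, a]) (hb : Hom[g, b])
    (hab : b ≤ a) (hκ : a + b = κ) (h1 : 2 * κ ≤ 3 * θ + 2) (h2 : θ < κ) (h3 : 3 ^ T ≤ θ + 1) :
    ∃ L : List (ℕ → MvPolynomial σ ℝ≥0), L.length ≤ s ∧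
      (∀ C ∈ L, Cont[T, κ, θ; C] ∧
        MvPolynomial.support (∏ j ∈ Finset.range (T + 1), C j) ⊆
          MvPolynomial.support (f * g)) ∧
      (∀ m ∈ MvPolynomial.support (f * g), ∃ C ∈ L,
        m ∈ MvPolynomial.support (∏ j ∈ Finset.range (T + 1), C j)) := by
  rcases Nat.eq_zero_or_pos T with rfl | hT
  · exact good_zero_depth (nnreal_mul_ne_zero hf0 hg0) (hκ ▸ hom_mul ha hb) hs
  obtain ⟨T', rfl⟩ : ∃ T', T = T' + 1 := ⟨T - 1, by omega⟩
  -- packaging: a cover of `f` by chains `C`, transformed by `Φ` with `∏ Φ C = (∏ C) * g`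
  have pack : ∀ (T₀ : ℕ) (L : List (ℕ → MvPolynomial σ ℝ≥0))
      (Φ : (ℕ → MvPolynomial σ ℝ≥0) → ℕ → MvPolynomial σ ℝ≥0),
      L.length ≤ s →
      (∀ C ∈ L, MvPolynomial.support (∏ j ∈ Finset.range (T₀ + 1), C j) ⊆ f.support) →
      (∀ m ∈ f.support, ∃ C ∈ L,
        m ∈ MvPolynomial.support (∏ j ∈ Finset.range (T₀ + 1), C j)) →
      (∀ C, ∏ j ∈ Finset.range (T' + 1 + 1), Φ C j = (∏ j ∈ Finset.range (T₀ + 1), C j) * g) →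
      (∀ C ∈ L, Cont[T' + 1, κ, θ; Φ C]) →
      ∃ L' : List (ℕ → MvPolynomial σ ℝ≥0), L'.length ≤ s ∧
        (∀ C ∈ L', Cont[T' + 1, κ, θ; C] ∧
          MvPolynomial.support (∏ j ∈ Finset.range (T' + 1 + 1), C j) ⊆
            MvPolynomial.support (f * g)) ∧
        (∀ m ∈ MvPolynomial.support (f * g), ∃ C ∈ L',
          m ∈ MvPolynomial.support (∏ j ∈ Finset.range (T' + 1 + 1), C j)) := by
    intro T₀ L Φ hL hsub hcov hprod hcont
    refine ⟨L.map Φ, by rw [List.length_map]; exact hL, fun C' hC' => ?_, fun m hm => ?_⟩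
    · obtain ⟨C, hC, rfl⟩ := List.mem_map.1 hC'
      refine ⟨hcont C hC, ?_⟩
      rw [hprod, support_mul_eq, support_mul_eq]
      exact Finset.add_subset_add_right (hsub C hC)
    · rw [support_mul_eq] at hm
      obtain ⟨x, hx, y, hy, rfl⟩ := Finset.mem_add.1 hm
      obtain ⟨C, hC, hxC⟩ := hcov x hx
      refine ⟨Φ C, List.mem_map.2 ⟨C, hC, rfl⟩, ?_⟩
      rw [hprod, support_mul_eq]
      exact Finset.add_mem_add hxC hy
  have hb' : b = κ - a := by omega
  by_cases hsplit : a ≤ θ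
  · -- split: `g` is a new head; the chains of `f` restart at the natural threshold of `a`
    obtain ⟨L, hL, hLC, hcov⟩ := hf T' a (2 * a / 3) hf0 ha (by omega) (by omega)
      (by
        have : 3 * 3 ^ T' ≤ 2 * a := by rw [← pow_succ']; omega
        omega)
    refine pack T' L (fun C j => if j = 0 then g else C (j - 1)) hL (fun C hC => (hLC C hC).2)
      hcov (fun C => prod_prepend g C (T' + 1)) fun C hC => ?_
    obtain ⟨K, hK0, hK1, hKc, hKd, hKl, hKn⟩ := (hLC C hC).1
    refine ⟨fun j => if j = 0 then κ else K (j - 1), by simp, fun _ => ?_, fun j hj hjT => ?_,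
      fun j hj => ?_, ?_, fun j hj => ?_⟩
    · simp only [Nat.succ_ne_zero, if_false, hK0]
      omega
    · obtain ⟨i, rfl⟩ : ∃ i, j = i + 1 := ⟨j - 1, by omega⟩
      simp only [Nat.succ_ne_zero, if_false, Nat.add_sub_cancel]
      rcases Nat.eq_zero_or_pos i with rfl | hi
      · have := hK1 (by omega)
        simp only [zero_add, hK0] at this ⊢
        omega
      · exact hKc i hi (by omega)
    · rcases Nat.eq_zero_or_pos j with rfl | hj0
      · simp only [if_true, zero_add, one_ne_zero, if_false, Nat.sub_self, hK0]
        exact ⟨by omega, hb' ▸ hb⟩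
      · obtain ⟨i, rfl⟩ : ∃ i, j = i + 1 := ⟨j - 1, by omega⟩
        simp only [Nat.succ_ne_zero, if_false, Nat.add_sub_cancel]
        exact hKd i (by omega)
    · simp only [Nat.succ_ne_zero, if_false, Nat.add_sub_cancel]
      exact hKl
    · rcases Nat.eq_zero_or_pos j with rfl | hj0
      · simpa using hg0
      · obtain ⟨i, rfl⟩ : ∃ i, j = i + 1 := ⟨j - 1, by omega⟩
        simp only [Nat.succ_ne_zero, if_false, Nat.add_sub_cancel]
        exact hKn i (by omega)
  · -- merge: `g` is multiplied into the heads of the chains of `f` (same threshold)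
    push Not at hsplit
    obtain ⟨L, hL, hLC, hcov⟩ := hf (T' + 1) a θ hf0 ha (by omega) hsplit h3
    refine pack (T' + 1) L (fun C j => if j = 0 then g * C 0 else C j) hL
      (fun C hC => (hLC C hC).2) hcov (fun C => prod_merge g C (T' + 1)) fun C hC => ?_
    obtain ⟨K, hK0, hK1, hKc, hKd, hKl, hKn⟩ := (hLC C hC).1
    refine ⟨fun j => if j = 0 then κ else K j, by simp, fun h => ?_, fun j hj hjT => ?_,
      fun j hj => ?_, ?_, fun j hj => ?_⟩
    · simp only [one_ne_zero, if_false]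
      exact hK1 h
    · obtain ⟨i, rfl⟩ : ∃ i, j = i + 1 := ⟨j - 1, by omega⟩
      simp only [Nat.succ_ne_zero, if_false]
      exact hKc (i + 1) hj hjT
    · rcases Nat.eq_zero_or_pos j with rfl | hj0
      · simp only [if_true, zero_add, one_ne_zero, if_false]
        have hK10 := (hKd 0 (by omega)).1
        rw [hK0] at hK10
        refine ⟨by omega, ?_⟩
        have h := hom_mul hb (hKd 0 (by omega)).2
        rw [hK0] at h
        have hdeg : b + (a - K 1) = κ - K (0 + 1) := by rw [zero_add]; omega
        rw [hdeg] at h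
        exact h
      · obtain ⟨i, rfl⟩ : ∃ i, j = i + 1 := ⟨j - 1, by omega⟩
        simp only [Nat.succ_ne_zero, if_false]
        exact hKd (i + 1) hj
    · simp only [Nat.succ_ne_zero, if_false]
      exact hKl
    · rcases Nat.eq_zero_or_pos j with rfl | hj0
      · simpa using nnreal_mul_ne_zero hg0 (hKn 0 (by omega))
      · obtain ⟨i, rfl⟩ : ∃ i, j = i + 1 := ⟨j - 1, by omega⟩
        simp only [Nat.succ_ne_zero, if_false]
        exact hKn (i + 1) hj

/-- Closure under products. [cite: HrubesYehudayoffHomogeneous2011, §3 (log-product lemma)] -/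
theorem good_mul {f g : MvPolynomial σ ℝ≥0} {s t : ℕ} (hf : Good[f, s]) (hg : Good[g, t])
    (hs : 1 ≤ s) (ht : 1 ≤ t) : Good[f * g, s + t] := by
  intro T κ θ h0 hh h1 h2 h3
  have hf0 : f ≠ 0 := fun h => h0 (by rw [h, zero_mul])
  have hg0 : g ≠ 0 := fun h => h0 (by rw [h, mul_zero])
  obtain ⟨a, b, hab, ha, hb⟩ := hom_of_mul hh hf0 hg0
  rcases le_total b a with hba | hba
  · obtain ⟨L, hL, hC, hcov⟩ := good_mul_of_le hf hs hf0 hg0 ha hb hba hab h1 h2 h3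
    exact ⟨L, by omega, hC, hcov⟩
  · obtain ⟨L, hL, hC, hcov⟩ :=
      good_mul_of_le hg ht hg0 hf0 hb ha hba (by omega) h1 h2 h3
    rw [mul_comm] at hC hcov
    exact ⟨L, by omega, hC, hcov⟩

end Summit.ValiantsHypothesis.ValiantsHypothesis.Theorems.MonotoneFormulaLB

namespace Summit.ValiantsHypothesis.ValiantsHypothesis.Theorems

/-- Registered helper stub of the TTRL variant V20269 (headline of this support file): over
`ℝ≥0`, the nonzero factors of a product all of whose monomials have degree `κ` are homogeneous
of complementary degrees. [folklore] -/
theorem stub_var20269_homOfMul {σ : Type} [DecidableEq σ] {f g : MvPolynomial σ NNReal} {κ : ℕ}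
    (h : ∀ m ∈ (f * g).support, Finsupp.degree m = κ) (hf : f ≠ 0) (hg : g ≠ 0) :
    ∃ a b : ℕ, a + b = κ ∧ (∀ m ∈ f.support, Finsupp.degree m = a) ∧
      (∀ m ∈ g.support, Finsupp.degree m = b) :=
  MonotoneFormulaLB.hom_of_mul h hf hg

end Summit.ValiantsHypothesis.ValiantsHypothesis.Theorems

end
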